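import Summits.QuantumFields.YangMills.Theorems.BalabanUVNodesN15KingModelCoverEtaRateDecay
import HarnessLib

/-!
# BalabanUVNodes ∕ N15 — THE KING-MODEL RUNG (PART Ͻ-h′): FINITE COVERS — THE PERIODISED EXPONENTIAL IN CLOSED FORM, UNIFORMLY IN THE COVER: `Σ_{b̃′ : π b̃′ = b} e^{−κ·d_{M′}(b̃,b̃′)}
# ≤ K_{d+1}(κ∕2)·e^{−(κ∕2)·d_M(π b̃, b)}`; hence KING's LEMMA 4.5 RATE WITH DECAY AT EVERY TORON OF FINITE-ORDER HOLONOMY WITH A MAJORANT INDEPENDENT OF THE ORDER: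
# `|(Δ^{(k+n)}_ω)⁻¹(b₀,b) − (Δ^{(k)}_ω)⁻¹(b₀,b)| ≤ C_diff·K_{d+1}(κ_m∕4)·L^{−k}·e^{−(κ_m∕4)·d_M(b₀,b)}`
# (Track A, DAG node N15 = NE2; FAN-OUT v1.1 §N15 s3 «KING-MODEL RUNG … NE2's analogue DECIDED in the model … + what the curved case adds»; count-neutral)

HONEST FRAMING.  Count-neutral (cell `pub-ymgap`, seat `pub-ymgap-dag-n15-e` g45; `--supports stmt-QuantumFields-27247 --as helper` = K3ᴬ, KEY MAP v3).  King's `A = 0`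
comparison model [King1986] at a constant abelian (flat) link field whose holonomy has finite order; one finite unit torus `T_M` at fixed spacings.  The constants are King's of
the tree (`CdiffM`, `kapM`, `gamM`) times the tree's lattice constant `B4Sect5Proof.latticeConst` ([Balaban1983RegularityDecay] Sect. 5 p.594 lattice sums); the decay rate is a quarter of
King's `κ_m` (two halvings: one in the tree's (4.41) interpolation, one here to separate the image sum from the base decay).  NOT Bałaban's `G_k(U)`; NOT a node discharge (N15 of
record untouched); nothing continuum ∕ ℝ⁴ ∕ OS ∕ Clay.

THE MATHEMATICS.  (1) THE COVERING PROJECTION IS 1-LIPSCHITZ for the torus distances: `d_M(π x̃, π ỹ) ≤ d_{M′}(x̃, ỹ)` — coordinatewise `dist(z, M_μℤ) ≤ dist(z, M′_μℤ)` because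
`M′_μℤ ⊂ M_μℤ` (`circAbs_le_circAbs_of_dvd`).  (2) Split `e^{−κd′} = e^{−(κ∕2)d′}e^{−(κ∕2)d′} ≤ e^{−(κ∕2)d_M(πx̃,b)}·e^{−(κ∕2)d′}` on the fibre of `b` and bound the remaining fibre sum by
the FULL torus sum `Σ_{ỹ ∈ T_{M′}}e^{−(κ∕2)d_{M′}(x̃,ỹ)} ≤ K_{d+1}(κ∕2)` (tree `tdistT_sumBound`, uniform in the periods).  (3) Insert in PART Ͻ-h.
PROVED HERE:
* §1 `circAbs_emod_sub_emod`, ★ `circAbs_le_circAbs_of_dvd`, ★★ **`tdistT_proj_le`** (`π` is 1-Lipschitz), `tdistT_proj_lift`;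
* §2 ★★ **`sum_fiber_exp_le`** (the periodised exponential, closed form, uniform in `M′`);
* §3 ★★ `norm_effLapTw_inv_apply_le_decay_closed` (`|(Δ^ω_{eff,k})⁻¹(π b̃,b)| ≤ (2∕γ_m)K_{d+1}(κ_m∕2)e^{−(κ_m∕2)d_M(π b̃,b)}`), ★★★ **`norm_effLapTw_inv_sub_apply_le_rate_closed`**
  (`|(Δ^{ω₂}_{eff,k+n})⁻¹ − (Δ^{ω₁}_{eff,k})⁻¹|(π b̃, b) ≤ C_diff·L^{−k}·K_{d+1}(κ_m∕4)·e^{−(κ_m∕4)·d_M(π b̃, b)}`), the base-point forms `…_closed'` (`b₀ ∈ T_M`, via the canonical lift) —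
  KING's LEMMA 4.5 (4.38) SHAPE `C·L^{−k}·e^{−δ|b₀−b|}` AT EVERY TORON OF FINITE-ORDER HOLONOMY, WITH `C, δ` INDEPENDENT OF THE ORDER (ready for the density step, PART Ͻ-i).
PRIOR TREE ART (by name): Ͻ-h (`norm_effLapTw_inv_apply_le_decay_cover`, `norm_effLapTw_inv_sub_apply_le_rate_cover`), Ͻ-b (`proj`, `proj_apply_val`, `lift`, `proj_lift`, `mem_fiber`),
`King1986.Torus` (`tdistT`, `tdistT_sumBound`, `exists_coord_eq_tdistT`, `circAbs_le_tdistT`, `tdistT_nonneg`, `CdiffM`, `kapM`, `gamM`, `kapM_pos_le`, `gamM_pos`, `CdiffM_nonneg`),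
`B4TorusKernel` (`circAbs`), `B4Sect5Proof.latticeConst`∕`latticeConst_nonneg`, `King1986.aK`.  Dedup (rg at filing): basename 0 files; needles
`tdistT_proj_le|sum_fiber_exp_le|circAbs_le_circAbs_of_dvd|rate_closed` 0 tree files.  presearch: n/a (elementary + composition).  Locators: [King1986] Lemma 4.5 (4.38) p.674, (4.34)
p.674, (4.39)–(4.41) pp.674–675; [Balaban1983RegularityDecay] Sect. 5 p.594 (lattice sums).  0 `sorry`, 0 `def`.
v1.1 (DOC-ONLY, ERRATUM-Ͻ1 = ref-I READ-1034 N2): v1.0 cited «[King1986] §4 p.670 l.8–13» as «the method of images»; King's lines invoke [Ba 4]'s MULTIPLE-REFLECTION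
representations (box propagators ∕ free boundary conditions ∕ the (2.13) operator on `ηℤ^d`, `A = 0`), not a periodisation — the finite-cover image sum is an elementary device of these files
([folklore]); that locator is withdrawn from the affected docstrings, every other locator stands; declarations byte-identical to v1.0.
-/

noncomputable section

open scoped BigOperators ComplexConjugate ComplexOrder
open Finset Matrix

namespace Summit.QuantumFields.YangMills.BalabanUVNodes.N15KingModelRung.Cover

open Literature.MathematicalPhysics.QuantumFieldTheory.Balaban1983to89.B5Prop11Plancherel (Tor fine)
open Literature.MathematicalPhysics.QuantumFieldTheory.Balaban1983to89.B4TorusKernel.MultiPeriod (circAbs)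
open Literature.MathematicalPhysics.QuantumFieldTheory.Balaban1983to89.B4Sect5Proof (latticeConst latticeConst_nonneg)
open Literature.MathematicalPhysics.QuantumFieldTheory.King1986 (aK)
open Literature.MathematicalPhysics.QuantumFieldTheory.King1986.Torus (tdistT tdistT_sumBound exists_coord_eq_tdistT circAbs_le_tdistT tdistT_nonneg CdiffM kapM gamM
  kapM_pos_le gamM_pos CdiffM_nonneg)
open Summit.QuantumFields.YangMills.BalabanUVNodes.N15KingModelRung.Toron (effLapTw)

variable {d : ℕ}

/-! ## §1 The covering projection is 1-Lipschitz for the torus distances -/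

/-- The circular distance only depends on the residue: `dist(a mod N − b mod N, Nℤ) = dist(a − b, Nℤ)`. [folklore] -/
theorem circAbs_emod_sub_emod (N : ℕ) (a b : ℤ) : circAbs N (a % (N : ℤ) - b % (N : ℤ)) = circAbs N (a - b) := by
  simp only [circAbs, Int.emod_sub_emod, Int.sub_emod_emod]

/-- ★ **COARSER PERIOD, SMALLER CIRCULAR DISTANCE**: `N ∣ N′ ⇒ dist(z, Nℤ) ≤ dist(z, N′ℤ)` (`N′ℤ ⊂ Nℤ`). [folklore] -/
theorem circAbs_le_circAbs_of_dvd {N N' : ℕ} (hN : 1 ≤ N) (hN' : 1 ≤ N') (h : N ∣ N') (z : ℤ) : circAbs N z ≤ circAbs N' z := by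
  obtain ⟨r, hr⟩ := h
  have hNz : (0 : ℤ) < N := by exact_mod_cast hN
  have hN'z : (0 : ℤ) < N' := by exact_mod_cast hN'
  have hdvd : (N : ℤ) ∣ (N' : ℤ) := ⟨r, by exact_mod_cast hr⟩
  set t' := z % (N' : ℤ) with ht'
  have ht : z % (N : ℤ) = t' % (N : ℤ) := (Int.emod_emod_of_dvd z hdvd).symm
  have ht'0 : 0 ≤ t' := Int.emod_nonneg _ hN'z.ne'
  have ht'lt : t' < N' := Int.emod_lt_of_pos _ hN'z
  set q := t' / (N : ℤ) with hq
  set t := t' % (N : ℤ) with htt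
  have hdec : (N : ℤ) * q + t = t' := Int.mul_ediv_add_emod t' N
  have ht0 : 0 ≤ t := Int.emod_nonneg _ hNz.ne'
  have hq0 : 0 ≤ q := Int.ediv_nonneg ht'0 hNz.le
  have hN'eq : (N' : ℤ) = N * r := by exact_mod_cast hr
  have hqr : q < r := by
    have h1 : (N : ℤ) * q < N * r := by
      calc (N : ℤ) * q ≤ t' := by linarith
        _ < N' := ht'lt
        _ = N * r := hN'eq
    exact lt_of_mul_lt_mul_left h1 hNz.le
  unfold circAbs
  rw [ht, ← ht']
  have hNq : 0 ≤ (N : ℤ) * q := mul_nonneg hNz.le hq0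
  refine min_le_min (by linarith) ?_
  have h2 : (N : ℤ) * 1 ≤ N * (r - q) := mul_le_mul_of_nonneg_left (by omega) hNz.le
  calc (N : ℤ) - t ≤ N * (r - q) - t := by linarith
    _ = N' - t' := by rw [hN'eq, ← hdec]; ring

variable {M M' : Fin (d + 1) → ℕ} [hM : ∀ μ, NeZero (M μ)] [hM' : ∀ μ, NeZero (M' μ)]

/-- Residues of the projection as integers: `val(π x̃)_μ = val(x̃_μ) mod M_μ`. [folklore] -/
theorem val_proj_cast (h : ∀ μ, M μ ∣ M' μ) (x : Tor M') (μ : Fin (d + 1)) : (((proj h x μ).val : ℕ) : ℤ) = ((x μ).val : ℤ) % (M μ : ℤ) := by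
  rw [proj_apply_val, ZMod.val_natCast, Int.natCast_emod]

/-- ★★ **THE COVERING PROJECTION IS 1-LIPSCHITZ**: `d_M(π x̃, π ỹ) ≤ d_{M′}(x̃, ỹ)` for King's (sup-circular) torus distances. [folklore] -/
theorem tdistT_proj_le (h : ∀ μ, M μ ∣ M' μ) (x y : Tor M') : tdistT M (proj h x) (proj h y) ≤ tdistT M' x y := by
  obtain ⟨μ, hμ⟩ := exists_coord_eq_tdistT M (Nat.succ_ne_zero d) (proj h x) (proj h y)
  rw [hμ, val_proj_cast, val_proj_cast, circAbs_emod_sub_emod]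
  calc ((circAbs (M μ) (((x μ).val : ℤ) - ((y μ).val : ℤ)) : ℤ) : ℝ)
      ≤ ((circAbs (M' μ) (((x μ).val : ℤ) - ((y μ).val : ℤ)) : ℤ) : ℝ) := by
        exact_mod_cast circAbs_le_circAbs_of_dvd (Nat.one_le_iff_ne_zero.mpr (NeZero.ne _)) (Nat.one_le_iff_ne_zero.mpr (NeZero.ne _)) (h μ) _
    _ ≤ tdistT M' x y := circAbs_le_tdistT M' x y μ

/-- On the fibre of `b`: `d_M(π x̃, b) ≤ d_{M′}(x̃, ỹ)` for every `ỹ` over `b`. [folklore] -/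
theorem tdistT_proj_le_of_mem_fiber (h : ∀ μ, M μ ∣ M' μ) (x : Tor M') {b : Tor M} {y : Tor M'} (hy : y ∈ fiber (proj h) b) :
    tdistT M (proj h x) b ≤ tdistT M' x y := by
  rw [← (mem_fiber (proj h) b y).mp hy]; exact tdistT_proj_le h x y

/-! ## §2 The periodised exponential, closed form -/

/-- ★★ **THE PERIODISED EXPONENTIAL, UNIFORMLY IN THE COVER**: `Σ_{ỹ : π ỹ = b} e^{−κ·d_{M′}(x̃, ỹ)} ≤ K_{d+1}(κ∕2)·e^{−(κ∕2)·d_M(π x̃, b)}` (`κ > 0`; `K` = the tree's `latticeConst`,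
independent of `M` and `M′`). [cite: Balaban1983RegularityDecay, Sect. 5 p.594 (lattice sums)] -/
theorem sum_fiber_exp_le (h : ∀ μ, M μ ∣ M' μ) {κ : ℝ} (hκ : 0 < κ) (x : Tor M') (b : Tor M) :
    ∑ y ∈ fiber (proj h) b, Real.exp (-(κ * tdistT M' x y)) ≤ latticeConst (d + 1) (κ / 2) * Real.exp (-(κ / 2 * tdistT M (proj h x) b)) := by
  have hsplit : ∀ y ∈ fiber (proj h) b, Real.exp (-(κ * tdistT M' x y)) ≤ Real.exp (-(κ / 2 * tdistT M' x y)) * Real.exp (-(κ / 2 * tdistT M (proj h x) b)) := by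
    intro y hy
    rw [← Real.exp_add]
    refine Real.exp_le_exp.mpr ?_
    have := tdistT_proj_le_of_mem_fiber h x hy
    nlinarith
  calc ∑ y ∈ fiber (proj h) b, Real.exp (-(κ * tdistT M' x y))
      ≤ ∑ y ∈ fiber (proj h) b, Real.exp (-(κ / 2 * tdistT M' x y)) * Real.exp (-(κ / 2 * tdistT M (proj h x) b)) := Finset.sum_le_sum hsplit
    _ = (∑ y ∈ fiber (proj h) b, Real.exp (-(κ / 2 * tdistT M' x y))) * Real.exp (-(κ / 2 * tdistT M (proj h x) b)) := by rw [Finset.sum_mul]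
    _ ≤ (∑ y, Real.exp (-(κ / 2 * tdistT M' x y))) * Real.exp (-(κ / 2 * tdistT M (proj h x) b)) :=
        mul_le_mul_of_nonneg_right (Finset.sum_le_univ_sum_of_nonneg fun y => (Real.exp_pos _).le) (Real.exp_pos _).le
    _ ≤ latticeConst (d + 1) (κ / 2) * Real.exp (-(κ / 2 * tdistT M (proj h x) b)) :=
        mul_le_mul_of_nonneg_right (tdistT_sumBound M' (κ / 2) (half_pos hκ) x) (Real.exp_pos _).le

/-! ## §3 King's Lemma 4.5 at a toron of finite-order holonomy, closed-form majorant independent of the order -/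

/-- ★★ **DECAY, CLOSED FORM**: `|(Δ^ω_{eff,k})⁻¹_{T_M}(π b̃, b)| ≤ (2∕γ_m)·K_{d+1}(κ_m∕2)·e^{−(κ_m∕2)·d_M(π b̃, b)}` for phases with `ω_μ^{L^kM′_μ} = 1`, `M_μ ∣ M′_μ`.
[cite: King1986, (4.34) p.674] -/
theorem norm_effLapTw_inv_apply_le_decay_closed (h : ∀ μ, M μ ∣ M' μ) {a m2 : ℝ} (ha : 0 < a) (hm : 0 < m2) {L k : ℕ} [NeZero L] (hL : 2 ≤ L) (hk : 1 ≤ k)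
    {ω : Fin (d + 1) → ℂ} (hω : ∀ μ, ω μ ^ fine (L ^ k) M' μ = 1) (b' : Tor M') (b : Tor M) :
    ‖(effLapTw (L ^ k) M (aK a L k) (((L ^ k : ℕ) : ℝ) ^ 2) m2 ω)⁻¹ (proj h b') b‖
      ≤ (2 / gamM a m2 L) * (latticeConst (d + 1) (kapM (d + 1) a m2 L / 2) * Real.exp (-(kapM (d + 1) a m2 L / 2 * tdistT M (proj h b') b))) := by
  have hγ := gamM_pos ha hm hL
  refine (norm_effLapTw_inv_apply_le_decay_cover h ha hm hL hk hω b' b).trans ?_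
  exact mul_le_mul_of_nonneg_left (sum_fiber_exp_le h (kapM_pos_le (d := d + 1) ha hm hL).1 b' b) (by positivity)

/-- ★★★ **KING's LEMMA 4.5 TWO-SPACING RATE WITH DECAY AT A TORON OF FINITE-ORDER HOLONOMY — CLOSED FORM, UNIFORM IN THE ORDER**: under the hypotheses of PART Ͻ-h
(`M_μ ∣ M′_μ`, trivial holonomy of both fine fields on the cover, same unit-lattice phases),
`|(Δ^{ω₂}_{eff,k+n})⁻¹_{T_M}(π b̃, b) − (Δ^{ω₁}_{eff,k})⁻¹_{T_M}(π b̃, b)| ≤ C_diff·L^{−k}·K_{d+1}(κ_m∕4)·e^{−(κ_m∕4)·d_M(π b̃, b)}` — the printed shape `CL^{−k}e^{−δ|x−y|}` of (4.38) with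
`C, δ` INDEPENDENT of `M′`. [cite: King1986, Lemma 4.5 (4.38) p.674, (4.39)–(4.41) pp.674–675] -/
theorem norm_effLapTw_inv_sub_apply_le_rate_closed (h : ∀ μ, M μ ∣ M' μ) {a m2 : ℝ} (ha : 0 < a) (hm : 0 < m2) {L k n : ℕ} [NeZero L] (hL : 2 ≤ L) (hk : 1 ≤ k)
    (hn : 1 ≤ n) {ω₁ ω₂ : Fin (d + 1) → ℂ} (hω₁ : ∀ μ, ω₁ μ ^ fine (L ^ k) M' μ = 1) (hω₂ : ∀ μ, ω₂ μ ^ fine (L ^ n * L ^ k) M' μ = 1)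
    (hθ : ∀ μ, ω₂ μ ^ (L ^ n * L ^ k) = ω₁ μ ^ (L ^ k)) (b' : Tor M') (b : Tor M) :
    ‖(effLapTw (L ^ n * L ^ k) M (aK a L (k + n)) (((L ^ n * L ^ k : ℕ) : ℝ) ^ 2) m2 ω₂)⁻¹ (proj h b') b
        - (effLapTw (L ^ k) M (aK a L k) (((L ^ k : ℕ) : ℝ) ^ 2) m2 ω₁)⁻¹ (proj h b') b‖
      ≤ CdiffM (d + 1) a m2 L * ((L : ℝ) ^ k)⁻¹
          * (latticeConst (d + 1) (kapM (d + 1) a m2 L / 4) * Real.exp (-(kapM (d + 1) a m2 L / 4 * tdistT M (proj h b') b))) := by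
  have hκ := (kapM_pos_le (d := d + 1) ha hm hL).1
  have hC := CdiffM_nonneg (d := d + 1) ha hm hL
  refine (norm_effLapTw_inv_sub_apply_le_rate_cover h ha hm hL hk hn hω₁ hω₂ hθ b' b).trans ?_
  have hs := sum_fiber_exp_le h (half_pos hκ) b' b
  rw [show kapM (d + 1) a m2 L / 2 / 2 = kapM (d + 1) a m2 L / 4 by ring] at hs
  exact mul_le_mul_of_nonneg_left hs (by positivity)

/-- ★★★ The same at a base point `b₀ ∈ T_M` (canonical lift): `|(Δ^{ω₂}_{eff,k+n})⁻¹(b₀,b) − (Δ^{ω₁}_{eff,k})⁻¹(b₀,b)| ≤ C_diff·L^{−k}·K_{d+1}(κ_m∕4)·e^{−(κ_m∕4)·d_M(b₀,b)}` — King's (4.38) at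
the toron, every pair of base points. [cite: King1986, Lemma 4.5 (4.38) p.674] -/
theorem norm_effLapTw_inv_sub_apply_le_rate_closed' (h : ∀ μ, M μ ∣ M' μ) {a m2 : ℝ} (ha : 0 < a) (hm : 0 < m2) {L k n : ℕ} [NeZero L] (hL : 2 ≤ L) (hk : 1 ≤ k)
    (hn : 1 ≤ n) {ω₁ ω₂ : Fin (d + 1) → ℂ} (hω₁ : ∀ μ, ω₁ μ ^ fine (L ^ k) M' μ = 1) (hω₂ : ∀ μ, ω₂ μ ^ fine (L ^ n * L ^ k) M' μ = 1)
    (hθ : ∀ μ, ω₂ μ ^ (L ^ n * L ^ k) = ω₁ μ ^ (L ^ k)) (b₀ b : Tor M) :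
    ‖(effLapTw (L ^ n * L ^ k) M (aK a L (k + n)) (((L ^ n * L ^ k : ℕ) : ℝ) ^ 2) m2 ω₂)⁻¹ b₀ b
        - (effLapTw (L ^ k) M (aK a L k) (((L ^ k : ℕ) : ℝ) ^ 2) m2 ω₁)⁻¹ b₀ b‖
      ≤ CdiffM (d + 1) a m2 L * ((L : ℝ) ^ k)⁻¹
          * (latticeConst (d + 1) (kapM (d + 1) a m2 L / 4) * Real.exp (-(kapM (d + 1) a m2 L / 4 * tdistT M b₀ b))) := by
  have := norm_effLapTw_inv_sub_apply_le_rate_closed h ha hm hL hk hn hω₁ hω₂ hθ (lift h b₀) b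
  rwa [proj_lift] at this

/-- ★★ Decay at a base point, closed form. [cite: King1986, (4.34) p.674] -/
theorem norm_effLapTw_inv_apply_le_decay_closed' (h : ∀ μ, M μ ∣ M' μ) {a m2 : ℝ} (ha : 0 < a) (hm : 0 < m2) {L k : ℕ} [NeZero L] (hL : 2 ≤ L) (hk : 1 ≤ k)
    {ω : Fin (d + 1) → ℂ} (hω : ∀ μ, ω μ ^ fine (L ^ k) M' μ = 1) (b₀ b : Tor M) :
    ‖(effLapTw (L ^ k) M (aK a L k) (((L ^ k : ℕ) : ℝ) ^ 2) m2 ω)⁻¹ b₀ b‖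
      ≤ (2 / gamM a m2 L) * (latticeConst (d + 1) (kapM (d + 1) a m2 L / 2) * Real.exp (-(kapM (d + 1) a m2 L / 2 * tdistT M b₀ b))) := by
  have := norm_effLapTw_inv_apply_le_decay_closed h ha hm hL hk hω (lift h b₀) b
  rwa [proj_lift] at this

end Summit.QuantumFields.YangMills.BalabanUVNodes.N15KingModelRung.Cover

end
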